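import Summits.Ventures.DiscreteObjects.Hadamard.Order333Centralizer668
import Summits.Ventures.DiscreteObjects.Hadamard.InvolutionTools

/-!
# H(668): the centraliser of an element of order 167 acts faithfully on its four row orbits (kernel)

Framing: lottery ticket; floor = certified bounds/negative ranges.

Cell pub-namedobj (venture DiscreteObjects), target (H), hadamard gen 19.  Companion of `Order333Centralizer668`.  Let
`σ = (π, κ, d, e)` be a signed automorphism of a Hadamard matrix of order `668` with `π^167 = κ^167 = 1`, `(π, κ) ≠ (1,1)`
(gen 9: no fixed row or column, `4 + 4` regular orbits of length `167`; gen 19: `H` is a `4 × 4` array of circulant blocks).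
If a signed automorphism `τ = (π', κ', d', e')` has row part commuting with `π` AND maps every ROW into its own `σ`-orbit
(`∀ x ∃ c, π' x = π^c x`; nothing is assumed on the column side), then **`(π', κ') = (π^c, κ^c)` for one `c`**
(`hadamard668_order167_centralizer_rowOrbits`):
different powers of the shift on different block rows, or a non-trivial action on the columns alone, are impossible.  So
`C(σ)/⟨σ⟩` acts faithfully on the four row orbits (and on the four column orbits): `|C(σ) : ⟨σ⟩|` divides `24` — e.g. the
quaternion-type block symmetries of the Williamson / Ito arrays, which commute with the shift and permute the blocks.  Proof:
with `π' x₀ = π^{c₀} x₀`, `ρ = τ σ^m` (`c₀ + m ≡ 0`) fixes the orbit of `x₀` pointwise (`167` rows) and is a power of `π` on every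
row orbit, so `π_ρ^167 = 1`; then the row part of `ρ^167` is trivial, hence its column part too (gen 12, `InvolutionTools`), so the
pair of `ρ` has order dividing `167`; order `167` would force NO fixed row (gen 9).  Structure of a hypothetical object; H(668)
untouched.  Ours; no `sorry`.
-/

namespace Summit.Ventures.DiscreteObjects.Hadamard

open Finset BigOperators Matrix

open Literature.Combinatorics.Designs.GoethalsSeidel (IsHadamardMatrix)

variable {ι : Type*} [Fintype ι] [DecidableEq ι]

/-- **Order 167: the orbit-preserving centraliser is `⟨σ⟩`** (row-side hypotheses only). -/
theorem hadamard668_order167_centralizer_rowOrbits {H : Matrix ι ι ℤ} (hH : IsHadamardMatrix H)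
    (hι : Fintype.card ι = 668) {π κ π' κ' : Equiv.Perm ι} {d e d' e' : ι → ℤ} (haut : IsSignedAut H π κ d e)
    (hπ : π ^ 167 = 1) (hκ : κ ^ 167 = 1) (hne : π ≠ 1 ∨ κ ≠ 1) (haut' : IsSignedAut H π' κ' d' e')
    (hcπ : Commute π' π) (hpres : ∀ x, ∃ c : ℕ, π' x = (π ^ c) x) :
    ∃ c : ℕ, π' = π ^ c ∧ κ' = κ ^ c := by
  have h167 := hadamard668_fixedRows_167 hH hι π κ d e haut hπ hκ hne
  have hπfix : ∀ x, π x ≠ x := moved_of_card_fixed_eq_zero π h167.1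
  have p167 : Nat.Prime 167 := by norm_num
  have hfree : ∀ x, ∀ k, 0 < k → k < 167 → (π ^ k) x ≠ x :=
    fun x => free_of_fixed_prime_pow π p167 (by rw [hπ, Equiv.Perm.one_apply]) (hπfix x)
  obtain ⟨x₀⟩ : Nonempty ι := Fintype.card_pos_iff.mp (by rw [hι]; norm_num)
  obtain ⟨c₀, hc₀⟩ := hpres x₀
  -- ρ = τ σ^m with c₀ + m ≡ 0 (mod 167)
  obtain ⟨m, q, hm⟩ : ∃ m q : ℕ, c₀ + m = 167 * q := ⟨167 - c₀ % 167, c₀ / 167 + 1, by omega⟩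
  have hρ := isSignedAut_mul haut' (isSignedAut_pow haut m)
  have hcρ : Commute (π' * π ^ m) π := hcπ.mul_left (Commute.pow_left (Commute.refl π) m)
  -- ρ is a power of π at every row, with exponent 0 at x₀
  have hρpow : ∀ x, ∃ c : ℕ, (π' * π ^ m) x = (π ^ c) x := by
    intro x
    obtain ⟨c, hc⟩ := hpres x
    refine ⟨c + m, ?_⟩
    rw [Equiv.Perm.mul_apply, comm_apply_pow_orbit hcπ hc m, ← Equiv.Perm.mul_apply, ← pow_add]
  have hρx₀ : (π' * π ^ m) x₀ = (π ^ 0) x₀ := by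
    rw [Equiv.Perm.mul_apply, comm_apply_pow_orbit hcπ hc₀ m, ← Equiv.Perm.mul_apply, ← pow_add, hm, pow_mul, hπ,
      one_pow, pow_zero]
  -- the row part of ρ^167 is trivial
  have hρ167 : (π' * π ^ m) ^ 167 = 1 := by
    ext x
    obtain ⟨c, hc⟩ := hρpow x
    rw [Equiv.Perm.one_apply, show x = (π ^ 0) x by simp, comm_pow_apply_pow_orbit hcρ hc 167 0, ← Equiv.Perm.mul_apply,
      ← pow_add, pow_zero, Equiv.Perm.one_apply, add_zero, pow_mul, hπ, one_pow, Equiv.Perm.one_apply]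
  -- hence so is the column part
  have hρ167' : (κ' * κ ^ m) ^ 167 = 1 := by
    have h := isSignedAut_pow hρ 167
    rw [hρ167] at h
    exact signedAut_snd_eq_one_of_fst_eq_one hH (by rw [hι]) (by rw [hι]; norm_num) h
  -- the pair of ρ has order 1 or 167; 167 is impossible (it fixes the orbit of x₀)
  set y : Equiv.Perm ι × Equiv.Perm ι := (π' * π ^ m, κ' * κ ^ m) with hy
  have hy167 : y ^ 167 = 1 := by rw [hy, Prod.pow_mk, hρ167, hρ167']; rfl
  haveI : Fact (Nat.Prime 167) := ⟨p167⟩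
  have hone : y = 1 := by
    by_contra hy1
    have hord : orderOf y = 167 := orderOf_eq_prime hy167 hy1
    rw [hy] at hord
    obtain ⟨h1, h2, h3⟩ := pow_data_of_orderOf hord (a := 1) Nat.one_pos (by norm_num)
    rw [pow_one, pow_one] at h3
    have h0 := (hadamard668_fixedRows_167 hH hι _ _ _ _ hρ h1 h2 h3).1
    -- but the orbit of x₀ is fixed
    have hsub : orbFin π 167 x₀ ⊆ univ.filter fun i => (π' * π ^ m) i = i := by
      intro z hz
      obtain ⟨k, -, rfl⟩ := Finset.mem_image.mp hz
      rw [Finset.mem_filter]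
      refine ⟨Finset.mem_univ _, ?_⟩
      rw [comm_apply_pow_orbit hcρ hρx₀ k, pow_zero, Equiv.Perm.one_apply]
    have hcard := Finset.card_le_card hsub
    rw [card_orbFin_of_free (hfree x₀), h0] at hcard
    omega
  rw [hy, Prod.mk_eq_one] at hone
  refine ⟨166 * m, ?_, ?_⟩
  · have hb : π ^ m * π ^ (166 * m) = 1 := by
      rw [← pow_add, show m + 166 * m = 167 * m by ring, pow_mul, hπ, one_pow]
    calc π' = π' * (π ^ m * π ^ (166 * m)) := by rw [hb, mul_one]
      _ = (π' * π ^ m) * π ^ (166 * m) := by rw [mul_assoc]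
      _ = π ^ (166 * m) := by rw [hone.1, one_mul]
  · have hb : κ ^ m * κ ^ (166 * m) = 1 := by
      rw [← pow_add, show m + 166 * m = 167 * m by ring, pow_mul, hκ, one_pow]
    calc κ' = κ' * (κ ^ m * κ ^ (166 * m)) := by rw [hb, mul_one]
      _ = (κ' * κ ^ m) * κ ^ (166 * m) := by rw [mul_assoc]
      _ = κ ^ (166 * m) := by rw [hone.2, one_mul]

end Summit.Ventures.DiscreteObjects.Hadamard
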